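import Summits.QuantumAdvantage.QuantumAdvantage.Theorems.LinnikCubicClassGroupsDegreeOnePrimesEscapeDivisionPNTWindow
import Summits.QuantumAdvantage.QuantumAdvantage.Theorems.LinnikCubicClassGroupsDegreeOnePrimesEscapePureCubicInertPrime
import Summits.QuantumAdvantage.QuantumAdvantage.Theorems.ThirdFactorialPincerSexticEscapeCount
import Literature.NumberTheory.LFunctions.DedekindZetaEntireConvexity
import Mathlib.NumberTheory.NumberField.Cyclotomic.Basic
import HarnessLib

/-!
# No exceptional term when the quadratic subfields are zero-free near `1`; pure cubic closures

Topic `Summits/QuantumAdvantage/QuantumAdvantage/Theorems`, cell B2b-1 (linnik-cubic), PART A (gen 10);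
helper toward the crux `DegreeOnePrimesEscape` (stmt-QuantumAdvantage-11543) of route
`LinnikCubicClassGroups`.  HONEST FRAMING: the value of this file is a THEOREM (kernel-checked, GRH-free,
Siegel-free, no hypothesis) — NOT summit progress.

The exceptional term of the division prime number theorem comes from a real zero of `ζ_N` near `1`, which
by Heilbronn–Stark is a zero of `ζ_k` for a QUADRATIC subfield `k ⊆ N`
(`exists_quadratic_subfield_zero_of_exceptional`).  Hence:

* `division_PNT_of_quadratic_zeroFree` — for `n > 1`, `0 < ε ≤ 1`, `c₀ > 0` there is `L > 0` such that for
  every Galois `N` of degree `n` ALL of whose quadratic subfields `k` have `ζ_k(β) ≠ 0` on `[1 − c₀, 1)`, and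
  every `σ`: `|S(x) − δ x| ≤ ε δ x` for all `x ≥ |d_N|^L` (no exceptional term; `division_PNT_window` with
  window constant `≤ c₀`);
* `quadratic_subfield_unique` — a number field whose degree is not divisible by `4` has at most one
  quadratic subfield;
* `division_PNT_sextic_cyclotomic` — **the Galois closures `N = ℚ(∛m, ζ₃)` of the pure cubic fields**
  (Galois of degree `6` containing a primitive cube root of unity): their only quadratic subfield is
  `ℚ(ζ₃) = ℚ(√−3)`, whose zeta function is zero-free on a fixed `[1 − c₃, 1)` (the tree's
  `exists_zeroFree_quadratic_of_discr_eq_neg_three`), so for EVERY such `N`, every `σ ∈ Gal(N/ℚ)` and every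
  `x ≥ |d_N|^L`: `|S(x) − δ x| ≤ ε δ x` — the Chebotarev prime number theorem in the Linnik range for the
  route's own family, unconditionally and WITHOUT exceptional term (absolute `L = L(ε)`).
[cite: LagariasMontgomeryOdlyzko1979, Theorem 1.1] [cite: Stark1974, Theorem 3]
-/

noncomputable section

open scoped NumberField nonZeroDivisors
open Finset Real Ideal NumberField
open Literature.NumberTheory.NumberFields Literature.NumberTheory.LFunctions
  Literature.NumberTheory.LFunctions.NumberField

namespace Summit.QuantumAdvantage.QuantumAdvantage.Theorems.DegreeOnePrimesEscape

/-! ### The exceptional zero lives in a quadratic subfield -/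

/-- **Heilbronn–Stark, subfield form**: a real zero `β₁` of `ζ_N` in the window
`(1 − c/(log|d_N| + log 4), 1)`, `c ≤ 1/4`, is a zero of `ζ_k` for a quadratic subfield `k ⊆ N`.
[cite: Stark1974, Theorem 3] -/
theorem exists_quadratic_subfield_zero_of_exceptional {N : Type} [Field N] [NumberField N] [IsGalois ℚ N]
    (hN : 1 < Module.finrank ℚ N) {c : ℝ} (hc4 : c ≤ 1 / 4) {β₁ : ℝ} (h0 : dedekindZeta₁ N β₁ = 0)
    (hβ : 1 - c / (Real.log ((NumberField.discr N).natAbs : ℝ) + Real.log 4) < β₁) (hβ1 : β₁ < 1) :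
    ∃ k : IntermediateField ℚ N, Module.finrank ℚ k = 2 ∧ dedekindZetaCont k β₁ = 0 := by
  obtain ⟨K₁, hK₁, hHS⟩ := exists_index_two_of_exceptional hN hc4 h0 hβ hβ1
  refine ⟨IntermediateField.fixedField K₁, ?_, ?_⟩
  · have h1 : Module.finrank (IntermediateField.fixedField K₁) N = Nat.card K₁ :=
      IntermediateField.finrank_fixedField_eq_card K₁
    have h2 := Module.finrank_mul_finrank ℚ (IntermediateField.fixedField K₁) N
    have h3 : K₁.index * Nat.card K₁ = Nat.card (N ≃ₐ[ℚ] N) := Subgroup.index_mul_card K₁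
    rw [hK₁, IsGalois.card_aut_eq_finrank] at h3
    rw [h1] at h2
    have hpos : 0 < Nat.card K₁ := Nat.card_pos
    have : Module.finrank ℚ (IntermediateField.fixedField K₁) * Nat.card K₁ = 2 * Nat.card K₁ := by
      rw [h2, ← h3]
    exact Nat.eq_of_mul_eq_mul_right hpos this
  · exact (dedekindZetaCont_eq_zero_of_dedekindZeta₁_eq_zero ((hHS K₁).mpr le_rfl)).2

/-! ### No exceptional term off the zeros of the quadratic subfields -/

set_option maxHeartbeats 800000 in
open scoped Classical in
/-- **No exceptional term when the quadratic subfields are zero-free on `[1 − c₀, 1)`**: for `n > 1`,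
`0 < ε ≤ 1`, `c₀ > 0` there is `L > 0` such that for every Galois `N` of degree `n` with `ζ_k(β) ≠ 0` for
every quadratic subfield `k ⊆ N` and every `β ∈ [1 − c₀, 1)`, every `σ` and every `x ≥ |d_N|^L`:
`|S(x) − δ x| ≤ ε δ x`.  Unconditional. [cite: LagariasMontgomeryOdlyzko1979, Theorem 1.1] -/
theorem division_PNT_of_quadratic_zeroFree (n : ℕ) (hn : 1 < n) {ε : ℝ} (hε : 0 < ε) (hε1 : ε ≤ 1)
    {c₀ : ℝ} (hc₀ : 0 < c₀) :
    ∃ L : ℝ, 0 < L ∧ ∀ (N : Type) [Field N] [NumberField N] [IsGalois ℚ N], Module.finrank ℚ N = n →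
      (∀ k : IntermediateField ℚ N, Module.finrank ℚ k = 2 →
        ∀ β : ℝ, 1 - c₀ ≤ β → β < 1 → dedekindZetaCont k β ≠ 0) →
      ∀ σ : N ≃ₐ[ℚ] N, ∀ x : ℝ, ((NumberField.discr N).natAbs : ℝ) ^ L ≤ x →
        |∑ p ∈ (Nat.primesLE ⌊x⌋₊).filter
            (fun p : ℕ => ¬ ((p : ℤ) ∣ NumberField.discr N) ∧
              ∃ (Q : Ideal (𝓞 N)) (_ : Q.IsMaximal) (_ : Q.LiesOver (span {(p : ℤ)})) (φ g : N ≃ₐ[ℚ] N),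
                IsArithFrobAt ℤ φ Q ∧ Q.inertia (N ≃ₐ[ℚ] N) = ⊥ ∧
                  Subgroup.zpowers (g * φ * g⁻¹) = Subgroup.zpowers σ), Real.log p -
          (Nat.card {τ : N ≃ₐ[ℚ] N // ∃ g : N ≃ₐ[ℚ] N,
              Subgroup.zpowers (g * τ * g⁻¹) = Subgroup.zpowers σ} : ℝ) / Nat.card (N ≃ₐ[ℚ] N) * x| ≤
          ε * ((Nat.card {τ : N ≃ₐ[ℚ] N // ∃ g : N ≃ₐ[ℚ] N,
              Subgroup.zpowers (g * τ * g⁻¹) = Subgroup.zpowers σ} : ℝ) / Nat.card (N ≃ₐ[ℚ] N) * x) := by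
  obtain ⟨L, c, hL, hc, hcc₀, hc4, h⟩ := division_PNT_window n hn hε hε1 hc₀
  refine ⟨L, hL, fun N _ _ _ hN hzf σ x hx => ?_⟩
  have hN1 : 1 < Module.finrank ℚ N := by rw [hN]; exact hn
  refine (h N hN σ).1 ?_ x hx
  rintro ⟨β₁, hζ₁, hβ₁c, hβ₁1⟩
  obtain ⟨k, hk2, hk0⟩ := exists_quadratic_subfield_zero_of_exceptional hN1 hc4 hζ₁ hβ₁c hβ₁1
  -- the window lies inside `[1 − c₀, 1)` since `c ≤ c₀` and `log d + log 4 ≥ 1`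
  set d : ℝ := ((NumberField.discr N).natAbs : ℝ) with hd
  have hd3 : (3 : ℝ) ≤ d := three_le_natAbs_discr_real N hN1
  have hℓ : 1 ≤ Real.log d + Real.log 4 := by
    have h4 : 1 < Real.log 4 := by
      rw [show (4:ℝ) = 2 ^ 2 by norm_num, Real.log_pow]; have := Real.log_two_gt_d9; push_cast; linarith
    have := Real.log_nonneg (by linarith : (1 : ℝ) ≤ d)
    linarith
  have hwin : c / (Real.log d + Real.log 4) ≤ c₀ := by
    rw [div_le_iff₀ (by linarith)]; nlinarith
  exact hzf k hk2 β₁ (by linarith) hβ₁1 hk0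

/-! ### Fields with one quadratic subfield: the pure cubic closures -/

/-- **At most one quadratic subfield when `4 ∤ [N:ℚ]`** (two distinct quadratic subfields generate a
biquadratic subfield of degree `4`). -/
theorem quadratic_subfield_unique {N : Type*} [Field N] [NumberField N] (h4 : ¬ 4 ∣ Module.finrank ℚ N)
    (k k₀ : IntermediateField ℚ N) (hk : Module.finrank ℚ k = 2) (hk₀ : Module.finrank ℚ k₀ = 2) :
    k = k₀ := by
  by_contra hne
  set M : IntermediateField ℚ N := k ⊔ k₀ with hM
  have hle : Module.finrank ℚ M ≤ 4 := by
    have := IntermediateField.finrank_sup_le k k₀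
    rw [hk, hk₀] at this
    exact this
  have hdvd : 2 ∣ Module.finrank ℚ M := by
    have := IntermediateField.finrank_dvd_of_le_right (le_sup_left : k ≤ M)
    rwa [hk] at this
  have hne2 : Module.finrank ℚ M ≠ 2 := by
    intro h2
    have e1 : k = M := IntermediateField.eq_of_le_of_finrank_eq le_sup_left (by rw [hk, h2])
    have e2 : k₀ = M := IntermediateField.eq_of_le_of_finrank_eq le_sup_right (by rw [hk₀, h2])
    exact hne (e1.trans e2.symm)
  have hpos : 0 < Module.finrank ℚ M := Module.finrank_pos
  have h4M : Module.finrank ℚ M = 4 := by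
    obtain ⟨t, ht⟩ := hdvd
    interval_cases h : Module.finrank ℚ M <;> omega
  have htower := Module.finrank_mul_finrank ℚ M N
  rw [h4M] at htower
  exact h4 ⟨Module.finrank M N, htower.symm⟩

/-- `|d_{ℚ(ζ₃)}| = 3`: the discriminant of the third cyclotomic field is `−3`. -/
theorem discr_cyclotomicField_three : NumberField.discr (CyclotomicField 3 ℚ) = -3 := by
  haveI hI : IsCyclotomicExtension {3} ℚ (CyclotomicField 3 ℚ) :=
    CyclotomicField.isCyclotomicExtension 3 ℚ
  haveI : Fact (Nat.Prime 3) := ⟨Nat.prime_three⟩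
  have h := IsCyclotomicExtension.Rat.discr_prime 3 (CyclotomicField 3 ℚ)
  rw [h]; norm_num

set_option maxHeartbeats 800000 in
open scoped Classical in
/-- **The Chebotarev prime number theorem in the Linnik range for the Galois closures of the pure cubic
fields, with no exceptional term**: for `0 < ε ≤ 1` there is an absolute `L > 0` such that for every
Galois number field `N` of degree `6` containing a primitive cube root of unity (e.g. `N = ℚ(∛m, ζ₃)`),
every `σ ∈ Gal(N/ℚ)` and every `x ≥ |d_N|^L`: `|S(x) − δ x| ≤ ε δ x` (`δ = |Div σ|/6`,
`S(x) = Σ_{p ≤ x, p ∤ d_N, Frob_p ∈ Div σ} log p`).  Unconditional.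
[cite: LagariasMontgomeryOdlyzko1979, Theorem 1.1] -/
theorem division_PNT_sextic_cyclotomic {ε : ℝ} (hε : 0 < ε) (hε1 : ε ≤ 1) :
    ∃ L : ℝ, 0 < L ∧ ∀ (N : Type) [Field N] [NumberField N] [IsGalois ℚ N], Module.finrank ℚ N = 6 →
      (∃ ω : N, IsPrimitiveRoot ω 3) →
      ∀ σ : N ≃ₐ[ℚ] N, ∀ x : ℝ, ((NumberField.discr N).natAbs : ℝ) ^ L ≤ x →
        |∑ p ∈ (Nat.primesLE ⌊x⌋₊).filter
            (fun p : ℕ => ¬ ((p : ℤ) ∣ NumberField.discr N) ∧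
              ∃ (Q : Ideal (𝓞 N)) (_ : Q.IsMaximal) (_ : Q.LiesOver (span {(p : ℤ)})) (φ g : N ≃ₐ[ℚ] N),
                IsArithFrobAt ℤ φ Q ∧ Q.inertia (N ≃ₐ[ℚ] N) = ⊥ ∧
                  Subgroup.zpowers (g * φ * g⁻¹) = Subgroup.zpowers σ), Real.log p -
          (Nat.card {τ : N ≃ₐ[ℚ] N // ∃ g : N ≃ₐ[ℚ] N,
              Subgroup.zpowers (g * τ * g⁻¹) = Subgroup.zpowers σ} : ℝ) / Nat.card (N ≃ₐ[ℚ] N) * x| ≤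
          ε * ((Nat.card {τ : N ≃ₐ[ℚ] N // ∃ g : N ≃ₐ[ℚ] N,
              Subgroup.zpowers (g * τ * g⁻¹) = Subgroup.zpowers σ} : ℝ) / Nat.card (N ≃ₐ[ℚ] N) * x) := by
  obtain ⟨c₃, hc₃, -, hZ⟩ := SexticEscapeCount.exists_zeroFree_quadratic_of_discr_eq_neg_three
  obtain ⟨L, hL, h⟩ := division_PNT_of_quadratic_zeroFree 6 (by norm_num) hε hε1 hc₃
  refine ⟨L, hL, fun N _ _ _ hN hω σ x hx => h N hN ?_ σ x hx⟩
  obtain ⟨ω, hω⟩ := hω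
  obtain ⟨k₀, hk₀, ⟨e⟩⟩ := exists_quadratic_cyclotomic_subfield hω
  have hd : NumberField.discr k₀ = -3 := by
    rw [NumberField.discr_eq_discr_of_algEquiv _ e, discr_cyclotomicField_three]
  intro k hk β hβ hβ1
  have hkk : k = k₀ := quadratic_subfield_unique (by rw [hN]; decide) k k₀ hk hk₀
  subst hkk
  exact hZ k hk hd β hβ hβ1

end Summit.QuantumAdvantage.QuantumAdvantage.Theorems.DegreeOnePrimesEscape

end
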